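import Summits.QuantumFields.BalabanUV.T4Continuum.Support.AveragingDeficitFaceWords
import Summits.QuantumFields.BalabanUV.T4Continuum.Support.SmoothRefineBlocks
import HarnessLib

/-!
# T⁴ programme, node NE3 — row E-RES♯, sub-row (R♯3-prep): SLICE-SUPPORTED DIRECTIONS ALONG THE WORDS OF (42) AT A GENERAL
# BACKGROUND — the non-abelian analogue of `SmoothRefineSlices.asum_sliceLift_gammaWord`: every contour `Γ_{c,x}` of the
# coarse bond `c = (y, κ)` meets the last `κ`-slice of the block EXACTLY ONCE, the tree words and the reversed tree words never,
# the reversed central contour once (at its first bond); the linearised transport `dhol` and the push-forward `pushDir` of a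
# slice-supported direction are therefore ONE dressed insertion per contour

NE3 prover lineage P1, gen 20 (cell `pub-balaban`, unit `b2b-balaban-t4-ne3-p1`, row NE3 OWNER; journal RULING «E-RES♯ INTO ROWS»
l.14429: (R♯3a) = the push defect of the DRESSED slice lift).  Row NE3-R2's `AveragingDeficitFaceWords` classifies the words of
(42) against FACE-supported directions (one bond `b₀(c)` per coarse bond; only the on-axis contours see it).  The curl-controlled
lift of the surviving variant (R3) is the SLICE lift (`SmoothRefineBlocks.sliceLift`; flat analysis `NE3SliceLiftCurl`), supported
on ALL bonds of the last slices `res_μ z = L − 1`.  THIS FILE (identities only, no estimate):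

* §1 `SliceSupported L ψ` (zero off the last slices; `sliceLift` is slice-supported); tree words from a block corner carry no
  slice bond (`dhol_treeWord_eq_zero`);
* §2 the straight segment from `x = L•y + r` carries exactly ONE slice bond, at step `j₀ = L − 1 − r_κ`:
  **`dhol_seg_slice`** `dhol V ψ x (seg κ L) = Ad_{V(x → x + (j₀+1)e_κ)} ψ(x + j₀e_κ, κ)`; the reversed central contour:
  `dhol_back_slice = −ψ(b₀(c))`;
* §3 **`dhol_loopWord_slice`**: on the loop `Γ_{c,x} ∪ (−Γ_c)` of (42),
  `(δ_ψV) = Ad_{V(Γ_{Ly,x} ∪ [x, x+(j₀+1)e_κ])} ψ(slice bond of x) − Ad_{V(Γ_{c,x})} ψ(b₀(c))` — for EVERY block point `x`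
  (no on∕off-axis split: the slice is met by every contour);
* §4 **`pushDir_sliceSupported`**: `pushDir L V ψ (L•y) κ = ψ(b₀(c)) + Ad_{V(Γ_c)⁻¹}(J_{X_c}(X_c′))` — the same frame formula as
  for face-supported directions (`AveragingDeficitFaceWords.pushDir_faceSupported`), since the central contour's only slice bond
  is `b₀(c)`.

WHAT THIS PREPARES (not done here): (R♯3a) — for the DRESSED slice lift `ψ(b) = Ad_{V(tree path to b)⁻¹} φ(c)` the first term
of §3 is `φ(c)` up to the holonomy of a ladder loop of area ≤ (d−1)L² (‖· − 1‖ = O(L²a) on `SmallField V a`), so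
`‖pushDir L V ψ (L•y) κ − φ y κ‖ ≤ C(d,L)·a·‖φ y κ‖` after the near-identity expansions of `mlog`′ and `J`
(`AveragingDeficitNearIdentity`).

HONEST FRAMING.  Word bookkeeping on ONE lattice at ONE configuration (our frame); nothing about minimisers; no estimate; (RES♯),
T-E_w♯, NE3 NOT proved; spine PROVED 0∕9; finite T⁴ rung (B)+1 — NOT infinite volume, NOT mass gap, NOT `BetaPertH`, NOT Clay.
One `def` (`SliceSupported`, a support predicate — data, [folklore]); no `sorry`.  PLACEMENT: `Summits/QuantumFields/BalabanUV/`.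
HONEST DEPENDENCY (cell page 1): continuum YM on T⁴ ⇐ BetaPertH ∧ nine spine estimates (0/9 proved); BetaPertH ⇐ (D1) ∧ (D4) ∧
CAP+tail; G-an2-4 gates asym, D1 and NE2/3/4.
-/

set_option autoImplicit false

open scoped BigOperators Matrix Matrix.Norms.L2Operator Topology
open NormedSpace Finset Filter

namespace Summit.QuantumFields.BalabanUV.T4Continuum.NE3SliceWords

open Literature.MathematicalPhysics.QuantumFieldTheory.Balaban1983to89
open B7Prop1Explicit B7Prop2Explicit MatrixLog UnitaryModel
open T4AveragingDeficitWall hiding Site Plane Plaq Bond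
open T4AveragingDeficitNonAbelian (Ad_mul Ad_sub)
open AveragingDeficitTransport AveragingDeficitLocality AveragingDeficitNearIdentity AveragingDeficitSideDeriv
open AveragingDeficitResidualPairing AveragingDeficitTransportCalc AveragingDeficitPushForwardLinear
open AveragingDeficitFaceWords (faceSite)
open SmoothRefineBlocks (blk res sliceLift sliceLift_of_ne blk_res_eq_of res_boxVec blk_boxVec res_lt res_nonneg)

noncomputable section

variable {d : ℕ} {n : Type*} [Fintype n] [DecidableEq n]

/-! ## §1 Slice-supported directions; tree words carry no slice bond -/

/-- A direction SUPPORTED ON THE LAST SLICES: zero at every bond `(z, i)` with `res_i z ≠ L − 1`. [folklore] -/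
def SliceSupported (L : ℕ) (ψ : Site d → Fin d → Matrix n n ℂ) : Prop :=
  ∀ (z : Site d) (i : Fin d), res L z i ≠ (L : ℤ) - 1 → ψ z i = 0

omit [Fintype n] [DecidableEq n] in
/-- The slice lift of any coarse direction is slice-supported. [folklore] -/
theorem sliceSupported_sliceLift (L : ℕ) (φ : Site d → Fin d → Matrix n n ℂ) : SliceSupported L (sliceLift L φ) :=
  fun _ _ h => sliceLift_of_ne φ h

omit [Fintype n] [DecidableEq n] in
/-- The residue of `L•y + t` is `t` when `0 ≤ t < L` componentwise. [folklore] -/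
theorem res_corner_add {L : ℕ} (hL : 1 ≤ L) (y t : Site d) (h0 : ∀ i, 0 ≤ t i) (h1 : ∀ i, t i < L) :
    res L ((L : ℤ) • y + t) = t :=
  (blk_res_eq_of hL rfl h0 h1).2

omit [Fintype n] [DecidableEq n] in
/-- **Tree words from a block corner carry no slice bond**: a bond of `Γ_{Ly, Ly+r}` in direction `i` starts at a site whose
`i`-th residue is `< r_i ≤ L − 1`. [folklore] -/
theorem res_ne_of_mem_bondsOf_treeWord {L : ℕ} (hL : 1 ≤ L) (y : Site d) (r : Fin d → Fin L) {b : Site d × Fin d}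
    (hb : b ∈ bondsOf ((L : ℤ) • y) (treeWord (boxVec L r))) : res L b.1 b.2 ≠ (L : ℤ) - 1 := by
  obtain ⟨h1, h2⟩ := bondsOf_treeWord_lt _ (fun i => (AveragingDeficitFaceWords.boxVec_bounds L r i).1) _ b hb
  simp only [Pi.smul_apply, smul_eq_mul] at h1 h2
  have hr : boxVec L r b.2 < L := (AveragingDeficitFaceWords.boxVec_bounds L r b.2).2
  have hrL : boxVec L r b.2 ≤ (L : ℤ) - 1 := by omega
  -- `b.1 b.2 = L * y b.2 + t` with `0 ≤ t < L − 1`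
  unfold SmoothRefineBlocks.res
  have hL0 : (0 : ℤ) < L := by exact_mod_cast (show 0 < L by omega)
  have e : b.1 b.2 = (b.1 b.2 - (L : ℤ) * y b.2) + (L : ℤ) * y b.2 := by ring
  rw [e, Int.add_mul_emod_self_left, Int.emod_eq_of_lt (by omega) (by omega)]
  omega

/-- `(δ_ψV)(Γ_{Ly,Ly+r}) = 0` for a slice-supported `ψ`. [folklore] -/
theorem dhol_treeWord_eq_zero {L : ℕ} {V : Site d → Fin d → (Matrix n n ℂ)ˣ} {ψ : Site d → Fin d → Matrix n n ℂ} (hL : 1 ≤ L)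
    (hψ : SliceSupported L ψ) (y : Site d) (r : Fin d → Fin L) :
    dhol V ψ ((L : ℤ) • y) (treeWord (boxVec L r)) = 0 :=
  dhol_eq_zero_of_forall V _ _ fun _ hb => hψ _ _ (res_ne_of_mem_bondsOf_treeWord hL y r hb)

/-! ## §2 The straight segment meets the slice exactly once -/

omit [Fintype n] [DecidableEq n] in
/-- On the straight segment from `x = L•y + r`, the `κ`-residue of the `j`-th site (`j < L`) is `L − 1` iff `j = L − 1 − r_κ`.
[folklore] -/
theorem res_seg_eq_iff {L : ℕ} (hL : 1 ≤ L) (y : Site d) (κ : Fin d) (r : Fin d → Fin L) {j : ℕ} (hj : j < L) :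
    res L ((L : ℤ) • y + boxVec L r + (j : ℤ) • e κ) κ = (L : ℤ) - 1 ↔ j = L - 1 - (r κ : ℕ) := by
  have hrκ : (r κ : ℕ) < L := (r κ).isLt
  have hL0 : (0 : ℤ) < L := by exact_mod_cast (show 0 < L by omega)
  -- the κ-coordinate is `L·y_κ + (r_κ + j)`
  have eκ : ((L : ℤ) • y + boxVec L r + (j : ℤ) • e κ) κ = ((r κ : ℕ) + j : ℤ) + (L : ℤ) * y κ := by
    simp only [Pi.add_apply, Pi.smul_apply, smul_eq_mul, boxVec, e_apply, if_true, mul_one]; ring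
  unfold SmoothRefineBlocks.res
  rw [eκ, Int.add_mul_emod_self_left]
  by_cases hlt : (r κ : ℕ) + j < L
  · rw [Int.emod_eq_of_lt (by omega) (by omega)]
    omega
  · -- `r_κ + j = L + s` with `0 ≤ s ≤ L − 2`
    have e2 : ((r κ : ℕ) + j : ℤ) = (((r κ : ℕ) + j - L : ℕ) : ℤ) + (L : ℤ) * 1 := by omega
    rw [e2, Int.add_mul_emod_self_left, Int.emod_eq_of_lt (by omega) (by omega)]
    omega

/-- **The straight segment from `x = L•y + r` carries exactly one slice bond**, at step `j₀ = L − 1 − r_κ`: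
`(δ_ψV)([x, x + Le_κ]) = Ad_{V([x, x + (j₀+1)e_κ])} ψ(x + j₀e_κ, κ)`. [cite: Balaban1985Averaging, (14) p.19, (42) p.23] -/
theorem dhol_seg_slice {L : ℕ} {V : Site d → Fin d → (Matrix n n ℂ)ˣ} {ψ : Site d → Fin d → Matrix n n ℂ} (hL : 1 ≤ L)
    (hψ : SliceSupported L ψ) (y : Site d) (κ : Fin d) (r : Fin d → Fin L) :
    dhol V ψ ((L : ℤ) • y + boxVec L r) (seg κ (L : ℤ))
      = Ad (hol V ((L : ℤ) • y + boxVec L r) (seg κ (((L - 1 - (r κ : ℕ) : ℕ) : ℤ) + 1)))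
          (ψ ((L : ℤ) • y + boxVec L r + ((L - 1 - (r κ : ℕ) : ℕ) : ℤ) • e κ) κ) := by
  have hrκ : (r κ : ℕ) < L := (r κ).isLt
  exact dhol_seg_single V (ψ := ψ) ((L : ℤ) • y + boxVec L r) κ (k := L) (j₀ := L - 1 - (r κ : ℕ)) (by omega)
    fun j hj hne => hψ _ _ fun hres => hne ((res_seg_eq_iff hL y κ r hj).mp hres)

/-- The central contour (`r = 0`): `(δ_ψV)(Γ_c) = Ad_{V(Γ_c)} ψ(b₀(c))`, `b₀(c) = (Ly + (L−1)e_κ, κ)`. [folklore] -/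
theorem dhol_central_slice {L : ℕ} {V : Site d → Fin d → (Matrix n n ℂ)ˣ} {ψ : Site d → Fin d → Matrix n n ℂ} (hL : 1 ≤ L)
    (hψ : SliceSupported L ψ) (y : Site d) (κ : Fin d) :
    dhol V ψ ((L : ℤ) • y) (seg κ (L : ℤ)) = Ad (hol V ((L : ℤ) • y) (seg κ (L : ℤ))) (ψ (faceSite L y κ) κ) := by
  let r₀ : Fin d → Fin L := fun _ => ⟨0, hL⟩
  have hr₀ : boxVec L r₀ = 0 := by funext i; simp [boxVec, r₀]
  have h := dhol_seg_slice (V := V) hL hψ y κ r₀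
  rw [hr₀, add_zero] at h
  rw [h]
  have e1 : (((L - 1 - (r₀ κ : ℕ) : ℕ) : ℤ) + 1) = (L : ℤ) := by simp only [r₀]; omega
  have e2 : (((L - 1 - (r₀ κ : ℕ) : ℕ) : ℤ)) = (L : ℤ) - 1 := by simp only [r₀]; omega
  rw [e1, e2]
  rfl

/-- The reversed central contour from `Ly + Le_κ` carries exactly the slice bond `b₀(c)`, as its first bond:
`(δ_ψV)(−Γ_c) = −ψ(b₀(c))`. [folklore] -/
theorem dhol_back_slice {L : ℕ} {V : Site d → Fin d → (Matrix n n ℂ)ˣ} {ψ : Site d → Fin d → Matrix n n ℂ} (hL : 1 ≤ L)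
    (hψ : SliceSupported L ψ) (y : Site d) (κ : Fin d) :
    dhol V ψ ((L : ℤ) • y + (L : ℤ) • e κ) (seg κ (-(L : ℤ))) = -ψ (faceSite L y κ) κ := by
  obtain ⟨k, hk⟩ : ∃ k : ℕ, L = k + 1 := ⟨L - 1, by omega⟩
  have hL0 : (0 : ℤ) < L := by exact_mod_cast (show 0 < L by omega)
  have h := dhol_seg_neg_head V (ψ := ψ) ((L : ℤ) • y + (L : ℤ) • e κ) κ k fun j hj => hψ _ _ fun hres => ?_
  · rw [hk] at h ⊢
    rw [h]
    congr 2
    simp only [faceSite]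
    push_cast
    module
  · -- the site `Ly + Le_κ − (j+2)e_κ = L•y + (L − j − 2)e_κ` has κ-residue `L − j − 2 ≠ L − 1`
    have hj' : j + 2 ≤ L := by omega
    have eq1 : (L : ℤ) • y + (L : ℤ) • e κ - ((j : ℤ) + 2) • e κ = (L : ℤ) • y + ((L - (j + 2) : ℕ) : ℤ) • e κ := by
      rw [Nat.cast_sub hj']; push_cast; module
    rw [eq1] at hres
    have hres' := congr_fun (res_corner_add hL y (((L - (j + 2) : ℕ) : ℤ) • e κ)
      (fun i => by simp only [Pi.smul_apply, e_apply, smul_eq_mul]; split_ifs <;> simp)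
      (fun i => by
        simp only [Pi.smul_apply, e_apply, smul_eq_mul]
        split_ifs
        · simp only [mul_one]; exact_mod_cast (show L - (j + 2) < L by omega)
        · simp only [mul_zero]; exact hL0)) κ
    rw [hres] at hres'
    simp only [Pi.smul_apply, e_apply, if_true, smul_eq_mul, mul_one] at hres'
    omega

/-! ## §3 The loop `Γ_{c,x} ∪ (−Γ_c)` of (42) -/

/-- **THE LOOP `Γ_{c,x} ∪ (−Γ_c)` FOR A SLICE-SUPPORTED DIRECTION**: with `x = Ly + r` and `j₀ = L − 1 − r_κ`,
`(δ_ψV)(loop) = Ad_{V(Γ_{Ly,x} ∪ [x, x + (j₀+1)e_κ])} ψ(x + j₀e_κ, κ) − Ad_{V(Γ_{c,x})} ψ(b₀(c))` — EVERY contour meets the slice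
once (no on∕off-axis dichotomy). [cite: Balaban1985Averaging, (42) p.23] -/
theorem dhol_loopWord_slice {L : ℕ} {V : Site d → Fin d → (Matrix n n ℂ)ˣ} {ψ : Site d → Fin d → Matrix n n ℂ} (hL : 1 ≤ L)
    (hψ : SliceSupported L ψ) (y : Site d) (κ : Fin d) (r : Fin d → Fin L) :
    dhol V ψ ((L : ℤ) • y) (loopWord L κ (boxVec L r))
      = Ad (hol V ((L : ℤ) • y) (treeWord (boxVec L r) ++ seg κ (((L - 1 - (r κ : ℕ) : ℕ) : ℤ) + 1)))
          (ψ ((L : ℤ) • y + boxVec L r + ((L - 1 - (r κ : ℕ) : ℕ) : ℤ) • e κ) κ)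
        - Ad (hol V ((L : ℤ) • y) (gammaWord L κ (boxVec L r))) (ψ (faceSite L y κ) κ) := by
  -- the loop = (tree ++ seg ++ revtree) ++ back
  rw [loopWord, dhol_append, disp_gammaWord, dhol_back_slice hL hψ y κ, Ad_neg, ← sub_eq_add_neg]
  congr 1
  rw [gammaWord, dhol_append, disp_append, disp_treeWord, disp_seg]
  -- the reversed tree word vanishes
  have hrev : dhol V ψ ((L : ℤ) • y + (boxVec L r + (L : ℤ) • e κ)) (revWord (treeWord (boxVec L r))) = 0 := by
    have h := dhol_revWord V ψ ((L : ℤ) • y + (L : ℤ) • e κ) (treeWord (boxVec L r))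
    rw [disp_treeWord, show (L : ℤ) • y + (L : ℤ) • e κ + boxVec L r = (L : ℤ) • y + (boxVec L r + (L : ℤ) • e κ)
      by abel] at h
    rw [h, show (L : ℤ) • y + (L : ℤ) • e κ = (L : ℤ) • (y + e κ) by rw [smul_add],
      dhol_treeWord_eq_zero hL hψ (y + e κ) r, Ad_zero, neg_zero]
  rw [hrev, Ad_zero, add_zero, dhol_append, disp_treeWord, dhol_treeWord_eq_zero hL hψ y r, zero_add,
    dhol_seg_slice hL hψ y κ r, ← Ad_mul, hol_append, disp_treeWord]

/-- **DRESSED FORM**: with `W = V(Γ_{c,x})V(Γ_c)⁻¹` (the loop variable of (42)),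
`Ad_{W⁻¹}(δ_ψV)(loop) = Ad_{W⁻¹·V(Γ_{Ly,x} ∪ [x, x+(j₀+1)e_κ])} ψ(x + j₀e_κ, κ) − Ad_{V(Γ_c)} ψ(b₀(c))` (`W⁻¹V(Γ_{c,x}) = V(Γ_c)`).
[cite: Balaban1985Averaging, (42) p.23] -/
theorem Ad_inv_Wcx_dhol_loopWord_slice {L : ℕ} {V : Site d → Fin d → (Matrix n n ℂ)ˣ} {ψ : Site d → Fin d → Matrix n n ℂ}
    (hL : 1 ≤ L) (hψ : SliceSupported L ψ) (y : Site d) (κ : Fin d) (r : Fin d → Fin L) :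
    Ad (Wcx L V ((L : ℤ) • y) κ (boxVec L r))⁻¹ (dhol V ψ ((L : ℤ) • y) (loopWord L κ (boxVec L r)))
      = Ad ((Wcx L V ((L : ℤ) • y) κ (boxVec L r))⁻¹
            * hol V ((L : ℤ) • y) (treeWord (boxVec L r) ++ seg κ (((L - 1 - (r κ : ℕ) : ℕ) : ℤ) + 1)))
          (ψ ((L : ℤ) • y + boxVec L r + ((L - 1 - (r κ : ℕ) : ℕ) : ℤ) • e κ) κ)
        - Ad (hol V ((L : ℤ) • y) (seg κ (L : ℤ))) (ψ (faceSite L y κ) κ) := by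
  rw [dhol_loopWord_slice hL hψ y κ r, Ad_sub, ← Ad_mul, ← Ad_mul]
  congr 2
  rw [Wcx, mul_inv_rev, inv_inv, mul_assoc, inv_mul_cancel, mul_one]

/-! ## §4 The push-forward of a slice-supported direction -/

/-- **`pushDir L V ψ (c) = ψ(b₀(c)) + Ad_{V(Γ_c)⁻¹} J_{X_c}(X_c′)`** for a slice-supported `ψ` — the frame formula of
`AveragingDeficitFaceWords.pushDir_faceSupported` holds verbatim (the central contour's only slice bond is `b₀(c)`); the
contour sum `X_c′ = XavgDeriv L V ψ` is evaluated contour by contour by §3. [cite: Balaban1985Averaging, (42) p.23] -/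
theorem pushDir_sliceSupported {L : ℕ} {V : Site d → Fin d → (Matrix n n ℂ)ˣ} {ψ : Site d → Fin d → Matrix n n ℂ} (hL : 1 ≤ L)
    (hψ : SliceSupported L ψ) (y : Site d) (κ : Fin d) :
    pushDir L V ψ ((L : ℤ) • y) κ
      = ψ (faceSite L y κ) κ
        + Ad (hol V ((L : ℤ) • y) (seg κ (L : ℤ)))⁻¹
            (jexp (Xavg L V ((L : ℤ) • y) κ) (XavgDeriv L V ψ ((L : ℤ) • y) κ)) := by
  rw [pushDir, sideDeriv, dhol_central_slice hL hψ y κ, ← Ad_mul, Ad_add, ← Ad_mul]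
  have e1 : (bavg L V ((L : ℤ) • y) κ)⁻¹ * expUnit (Xavg L V ((L : ℤ) • y) κ) * hol V ((L : ℤ) • y) (seg κ (L : ℤ))
      = 1 := by
    rw [bavg]; group
  have e2 : (bavg L V ((L : ℤ) • y) κ)⁻¹ * expUnit (Xavg L V ((L : ℤ) • y) κ)
      = (hol V ((L : ℤ) • y) (seg κ (L : ℤ)))⁻¹ := by
    rw [bavg]; group
  rw [e1, e2, Ad_one, add_comm]

end

end Summit.QuantumFields.BalabanUV.T4Continuum.NE3SliceWords
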